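import Summits.QuantumFields.YangMills.Theorems.BalabanLadderNTLinkEquipartition
import Mathlib.Analysis.SpecificLimits.Normed
import HarnessLib

/-!
# Crux `NT` (stmt-QuantumFields-19353): the Gaussian Haar bound `∫ e^{−cβ‖ρg − ρg₀‖²} dσ ≤ K (1/√β)^D` on a compact matrix group
# (hypothesis-free tool)

Fleet lead prover of crux `NT` (unit `ym-spine-19353-p1`, g30).  For a compact group `G` with a faithful continuous unitary
representation `ρ : G →* M_N(ℂ)` (`D = dimE ρ`, `σ` the Haar probability measure):

* `exists_haar_gball_le_pow` — the small-ball CEILING `σ{‖ρ g − 1‖ ≤ a} ≤ c₃ a^D` for ALL radii `a > 0` (g9's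
  `exists_haar_gball_two_sided` for `a ≤ δ₀`, trivially beyond);
* `summable_shell` — `Σ_n e^{−c 4ⁿ} 2^{(n+1)D} < ∞` (`c > 0`; eventually dominated by `2^D 2^{−n}` since `n/4ⁿ → 0`);
* **`exists_integral_exp_neg_mul_normSq_le`** — for every `c > 0` there is `K > 0` with `∫ e^{−cβ‖ρg − ρg₀‖²} dσ(g) ≤ K (1/√β)^D`
  for all `β ≥ 1` and all centres `g₀` (the ball `r < 1/√β` and the dyadic shells `2ⁿ/√β ≤ r < 2ⁿ⁺¹/√β`, countable
  subadditivity of the lower integral, Hilbert–Schmidt balls being left translates).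

Used by `Theorems/BalabanLadderNTLinkKernelCeiling` (the one-link kernel ceiling on consistent exteriors).
HONEST FRAMING: finite-dimensional measure theory; nothing about NT, the seam or the gap; not Clay.
Refs: Chatterjee arXiv:1602.01222 §11 (small balls).
-/

set_option autoImplicit false

noncomputable section

open scoped Matrix Matrix.Norms.Frobenius ENNReal NNReal Topology BigOperators
open MeasureTheory Measure Filter Set Metric
open Literature.MathematicalPhysics.QuantumLattice
open Literature.MathematicalPhysics.QuantumFieldTheory hiding ZdEdge
open Summit.QuantumFields.YangMills.Theorems.FreeEnergyLogCoefficient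

namespace Summit.QuantumFields.YangMills.Cruxes.NT.LinkEquipartition

/-! ## The Gaussian Haar bound -/

section Gaussian

variable {N : ℕ} {G : Type*} [Group G] [TopologicalSpace G] [IsTopologicalGroup G] [CompactSpace G]
  [MeasurableSpace G] [BorelSpace G] (ρ : G →* Matrix (Fin N) (Fin N) ℂ)

/-- **Small-ball ceiling for all radii**: `σ{g : ‖ρ g − 1‖ ≤ a} ≤ c₃ a^D` for every `a > 0` (`D = dimE ρ`). [folklore] -/
theorem exists_haar_gball_le_pow (hρ : Continuous ρ) (hinj : Function.Injective ρ)
    (hU : ∀ g, ρ g ∈ Matrix.unitaryGroup (Fin N) ℂ) :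
    ∃ c₃ : ℝ, 0 < c₃ ∧ ∀ a : ℝ, 0 < a → (haarProbability G).real {g : G | ‖ρ g - 1‖ ≤ a} ≤ c₃ * a ^ dimE ρ := by
  obtain ⟨δ₀, c₁, c₂, hδ₀, hc₁, hc₂, hball⟩ := exists_haar_gball_two_sided ρ hρ hinj hU
  refine ⟨max c₂ (1 / δ₀ ^ dimE ρ), lt_of_lt_of_le hc₂ (le_max_left _ _), fun a ha => ?_⟩
  by_cases hle : a ≤ δ₀
  · exact (hball a ha hle).2.trans (mul_le_mul_of_nonneg_right (le_max_left _ _) (pow_nonneg ha.le _))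
  · have hlt : δ₀ < a := not_le.1 hle
    have h1 : (haarProbability G).real {g : G | ‖ρ g - 1‖ ≤ a} ≤ 1 := measureReal_le_one
    have h2 : (1 : ℝ) ≤ 1 / δ₀ ^ dimE ρ * a ^ dimE ρ := by
      rw [one_div_mul_eq_div, le_div_iff₀ (pow_pos hδ₀ _), one_mul]
      exact pow_le_pow_left₀ hδ₀.le hlt.le _
    exact h1.trans (h2.trans (mul_le_mul_of_nonneg_right (le_max_right _ _) (pow_nonneg ha.le _)))

omit [TopologicalSpace G] [IsTopologicalGroup G] [CompactSpace G] [MeasurableSpace G] [BorelSpace G] [Group G] in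
/-- The dyadic shell series `Σ_n e^{−c 4ⁿ} 2^{(n+1)D}` is summable (`c > 0`). [folklore] -/
theorem summable_shell {c : ℝ} (hc : 0 < c) (D : ℕ) :
    Summable (fun n : ℕ => Real.exp (-(c * 4 ^ n)) * 2 ^ ((n + 1) * D)) := by
  set Lg : ℝ := ((D : ℝ) + 1) * Real.log 2 with hLg
  have hLg0 : 0 ≤ Lg := mul_nonneg (by positivity) (Real.log_nonneg one_le_two)
  have hlim := tendsto_pow_const_div_const_pow_of_one_lt 1 (by norm_num : (1 : ℝ) < 4)
  have hev : ∀ᶠ n : ℕ in atTop, (n : ℝ) ^ 1 / 4 ^ n < c / (Lg + 1) :=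
    hlim.eventually (gt_mem_nhds (div_pos hc (by linarith)))
  refine Summable.of_norm_bounded_eventually_nat
    ((summable_geometric_of_lt_one (by norm_num : (0 : ℝ) ≤ 1 / 2) (by norm_num)).mul_left (2 ^ D)) ?_
  filter_upwards [hev] with n hn
  have h4 : (0 : ℝ) < 4 ^ n := pow_pos (by norm_num) n
  have hn' : (n : ℝ) * Lg ≤ c * 4 ^ n := by
    rw [pow_one, div_lt_div_iff₀ h4 (by linarith)] at hn
    nlinarith [mul_nonneg (Nat.cast_nonneg n) hLg0]
  rw [Real.norm_eq_abs, abs_of_nonneg (by positivity)]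
  -- `e^{−c 4ⁿ} ≤ e^{−n Lg} = (1/2)^{n (D+1)}`
  have h1 : Real.exp (-(c * 4 ^ n)) ≤ (1 / 2 : ℝ) ^ (n * (D + 1)) := by
    have e : (1 / 2 : ℝ) ^ (n * (D + 1)) = Real.exp (-((n : ℝ) * Lg)) := by
      rw [hLg, show (n : ℝ) * (((D : ℝ) + 1) * Real.log 2) = ((n * (D + 1) : ℕ) : ℝ) * Real.log 2 by push_cast; ring,
        Real.exp_neg, Real.exp_nat_mul, Real.exp_log two_pos, one_div, inv_pow]
    rw [e]
    exact Real.exp_le_exp.2 (by linarith)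
  calc Real.exp (-(c * 4 ^ n)) * 2 ^ ((n + 1) * D) ≤ (1 / 2 : ℝ) ^ (n * (D + 1)) * 2 ^ ((n + 1) * D) :=
        mul_le_mul_of_nonneg_right h1 (by positivity)
    _ = 2 ^ D * (1 / 2) ^ n := by
        rw [show n * (D + 1) = n * D + n by ring, show (n + 1) * D = n * D + D by ring, pow_add, pow_add, one_div_pow,
          one_div_pow]
        field_simp

/-- **THE GAUSSIAN HAAR BOUND.**  For every `c > 0` there is `K > 0` with
`∫ e^{−cβ‖ρ g − ρ g₀‖²} dσ(g) ≤ K · (1/√β)^D` for all `β ≥ 1` and all `g₀ ∈ G` (`σ` = Haar probability, `D = dimE ρ`). [folklore] -/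
theorem exists_integral_exp_neg_mul_normSq_le (hρ : Continuous ρ) (hinj : Function.Injective ρ)
    (hU : ∀ g, ρ g ∈ Matrix.unitaryGroup (Fin N) ℂ) {c : ℝ} (hc : 0 < c) :
    ∃ K : ℝ, 0 < K ∧ ∀ β : ℝ, 1 ≤ β → ∀ g₀ : G,
      ∫ g, Real.exp (-(c * β * ‖ρ g - ρ g₀‖ ^ 2)) ∂(haarProbability G) ≤ K * (1 / Real.sqrt β) ^ dimE ρ := by
  obtain ⟨c₃, hc₃, hball⟩ := exists_haar_gball_le_pow ρ hρ hinj hU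
  set D : ℕ := dimE ρ with hD
  set a : ℕ → ℝ := fun n => Real.exp (-(c * 4 ^ n)) * 2 ^ ((n + 1) * D) with ha
  have ha0 : ∀ n, 0 ≤ a n := fun n => by positivity
  have hsum : Summable a := summable_shell hc D
  set S : ℝ := ∑' n, a n with hS
  have hS0 : 0 ≤ S := tsum_nonneg ha0
  refine ⟨c₃ * (1 + S), by positivity, fun β hβ g₀ => ?_⟩
  have hβ0 : 0 < β := lt_of_lt_of_le one_pos hβ
  set δ : ℝ := 1 / Real.sqrt β with hδ
  have hδ0 : 0 < δ := div_pos one_pos (Real.sqrt_pos.2 hβ0)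
  have hδsq : δ ^ 2 * β = 1 := by rw [hδ, one_div, inv_pow, Real.sq_sqrt hβ0.le]; field_simp
  set σ := haarProbability G with hσ
  set r : G → ℝ := fun g => ‖ρ g - ρ g₀‖ with hr
  have hrcont : Continuous r := (hρ.sub continuous_const).norm
  have hrm : Measurable r := hrcont.measurable
  have hr0 : ∀ g, 0 ≤ r g := fun g => norm_nonneg _
  set F : G → ℝ := fun g => Real.exp (-(c * β * r g ^ 2)) with hF
  have hF0 : ∀ g, 0 ≤ F g := fun g => (Real.exp_pos _).le
  have hF1 : ∀ g, F g ≤ 1 := fun g => Real.exp_le_one_iff.2 (by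
    have : 0 ≤ c * β * r g ^ 2 := by positivity
    linarith)
  have hFcont : Continuous F := Real.continuous_exp.comp ((continuous_const.mul (hrcont.pow 2)).neg)
  -- Haar measure of the balls around `g₀`, in `ℝ≥0∞`
  have hballE : ∀ t : ℝ, 0 < t → σ {g | r g ≤ t} ≤ ENNReal.ofReal (c₃ * t ^ D) := by
    intro t ht
    have h1 : σ.real {g | r g ≤ t} ≤ c₃ * t ^ D := by
      have e : σ.real {g | r g ≤ t} = σ.real {g : G | ‖ρ g - 1‖ ≤ t} := by
        rw [measureReal_def, measureReal_def]
        exact congrArg ENNReal.toReal (haar_setOf_norm_sub_le ρ hU g₀ t)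
      rw [e]; exact hball t ht
    rw [← ofReal_measureReal]
    exact ENNReal.ofReal_le_ofReal h1
  -- the ball and the dyadic shells
  set B : Set G := {g | r g < δ} with hB
  set T : ℕ → Set G := fun n => {g | 2 ^ n * δ ≤ r g ∧ r g < 2 ^ (n + 1) * δ} with hT
  have hTm : ∀ n, MeasurableSet (T n) := fun n =>
    (measurableSet_le measurable_const hrm).inter (measurableSet_lt hrm measurable_const)
  have hcover : (Set.univ : Set G) ⊆ B ∪ ⋃ n, T n := by
    intro g _
    by_cases hg : r g < δ
    · exact Or.inl hg
    · right
      have hx : 1 ≤ r g / δ := by rw [le_div_iff₀ hδ0, one_mul]; exact not_lt.1 hg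
      obtain ⟨n, hn1, hn2⟩ := exists_nat_pow_near hx one_lt_two
      refine Set.mem_iUnion.2 ⟨n, ?_, ?_⟩
      · exact (le_div_iff₀ hδ0).1 hn1
      · exact (div_lt_iff₀ hδ0).1 hn2
  -- the lower integral, piece by piece
  have hBle : ∫⁻ g in B, ENNReal.ofReal (F g) ∂σ ≤ ENNReal.ofReal (c₃ * δ ^ D) := by
    calc ∫⁻ g in B, ENNReal.ofReal (F g) ∂σ ≤ ∫⁻ _g in B, 1 ∂σ :=
          setLIntegral_mono measurable_const fun g _ => by
            rw [← ENNReal.ofReal_one]; exact ENNReal.ofReal_le_ofReal (hF1 g)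
      _ = σ B := by rw [setLIntegral_const, one_mul]
      _ ≤ σ {g | r g ≤ δ} := measure_mono fun g (hg : r g < δ) => hg.le
      _ ≤ ENNReal.ofReal (c₃ * δ ^ D) := hballE δ hδ0
  have hTle : ∀ n, ∫⁻ g in T n, ENNReal.ofReal (F g) ∂σ ≤ ENNReal.ofReal (c₃ * δ ^ D * a n) := by
    intro n
    have h2n : (0 : ℝ) < 2 ^ n := pow_pos two_pos n
    have hsup : ∀ g ∈ T n, ENNReal.ofReal (F g) ≤ ENNReal.ofReal (Real.exp (-(c * 4 ^ n))) := by
      intro g hg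
      refine ENNReal.ofReal_le_ofReal (Real.exp_le_exp.2 ?_)
      have hlo : 2 ^ n * δ ≤ r g := hg.1
      have hsq : (2 ^ n * δ) ^ 2 ≤ r g ^ 2 := pow_le_pow_left₀ (by positivity) hlo 2
      have e : c * β * (2 ^ n * δ) ^ 2 = c * 4 ^ n := by
        rw [mul_pow, ← pow_mul, show (2 : ℝ) ^ (n * 2) = 4 ^ n by rw [mul_comm, pow_mul]; norm_num]
        have : c * β * ((4 : ℝ) ^ n * δ ^ 2) = c * 4 ^ n * (δ ^ 2 * β) := by ring
        rw [this, hδsq, mul_one]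
      have := mul_le_mul_of_nonneg_left hsq (by positivity : 0 ≤ c * β)
      linarith
    calc ∫⁻ g in T n, ENNReal.ofReal (F g) ∂σ ≤ ∫⁻ _g in T n, ENNReal.ofReal (Real.exp (-(c * 4 ^ n))) ∂σ :=
          setLIntegral_mono measurable_const hsup
      _ = ENNReal.ofReal (Real.exp (-(c * 4 ^ n))) * σ (T n) := setLIntegral_const _ _
      _ ≤ ENNReal.ofReal (Real.exp (-(c * 4 ^ n))) * ENNReal.ofReal (c₃ * (2 ^ (n + 1) * δ) ^ D) := by
          have hsub : T n ⊆ {g | r g ≤ 2 ^ (n + 1) * δ} := fun g hg => (show r g < 2 ^ (n + 1) * δ from hg.2).le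
          exact mul_le_mul_of_nonneg_left ((measure_mono hsub).trans (hballE (2 ^ (n + 1) * δ) (by positivity)))
            bot_le
      _ = ENNReal.ofReal (c₃ * δ ^ D * a n) := by
          rw [← ENNReal.ofReal_mul (Real.exp_pos _).le]
          have e3 : Real.exp (-(c * 4 ^ n)) * (c₃ * (2 ^ (n + 1) * δ) ^ D) = c₃ * δ ^ D * a n := by
            simp only [ha, mul_pow]
            ring
          rw [e3]
  -- assemble
  have hL : ∫⁻ g, ENNReal.ofReal (F g) ∂σ ≤ ENNReal.ofReal (c₃ * (1 + S) * δ ^ D) := by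
    calc ∫⁻ g, ENNReal.ofReal (F g) ∂σ = ∫⁻ g in Set.univ, ENNReal.ofReal (F g) ∂σ := (setLIntegral_univ _).symm
      _ ≤ ∫⁻ g in B ∪ ⋃ n, T n, ENNReal.ofReal (F g) ∂σ := lintegral_mono_set hcover
      _ ≤ ∫⁻ g in B, ENNReal.ofReal (F g) ∂σ + ∫⁻ g in ⋃ n, T n, ENNReal.ofReal (F g) ∂σ := lintegral_union_le _ _ _
      _ ≤ ENNReal.ofReal (c₃ * δ ^ D) + ∑' n, ∫⁻ g in T n, ENNReal.ofReal (F g) ∂σ :=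
          add_le_add hBle (lintegral_iUnion_le _ _)
      _ ≤ ENNReal.ofReal (c₃ * δ ^ D) + ∑' n, ENNReal.ofReal (c₃ * δ ^ D * a n) :=
          add_le_add le_rfl (ENNReal.tsum_le_tsum hTle)
      _ = ENNReal.ofReal (c₃ * δ ^ D) + ENNReal.ofReal (c₃ * δ ^ D * S) := by
          rw [← ENNReal.ofReal_tsum_of_nonneg (fun n => by positivity) (hsum.mul_left _), tsum_mul_left]
      _ = ENNReal.ofReal (c₃ * (1 + S) * δ ^ D) := by
          rw [← ENNReal.ofReal_add (by positivity) (by positivity)]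
          congr 1; ring
  have hint : Integrable F σ := hFcont.integrable_of_hasCompactSupport (HasCompactSupport.of_compactSpace _)
  rw [integral_eq_lintegral_of_nonneg_ae (ae_of_all _ hF0) hint.aestronglyMeasurable]
  exact ENNReal.toReal_le_of_le_ofReal (by positivity) hL

end Gaussian

end Summit.QuantumFields.YangMills.Cruxes.NT.LinkEquipartition

end
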